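import Mathlib
import Summits.Ventures.HodgeRepro2.LevelPositivity
import Summits.Ventures.HodgeRepro2.T5DualPairSwap

/-!
# T6N42Defs — sub-step N4.2 «finite places: the local theta lift of π₀,v is non-zero»: the carriers

Tier 6 (README §10; route/TARGET-T6.md §3 row N4.2, §4 L4): the M2 sub-step N4.2 is TIER5 §N4.2
(route/T5-route-3.md v0.36 §B rows B0–B2 and §K.2) — at every finite place `v` of `F⁺`, the local
theta lift `Θ(π₀,v)` of `π₀,v = θ_{W₁₂,v}(β′_v)` to `U(V_v)` is non-zero: at the places split in
`E` by Mínguez 2008 Thm. 1(2) (type II dual pairs), at the non-split places by Gan–Ichino 2014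
Prop. 5.3(i) (the tower property) with first occurrence index `r₀ = 0`; GQT's Prop. 35(i) then
turns «Θ ≠ 0» into the zeta-integral form «Z_v^*(½) ≢ 0» (an author-copy source, README §9(iv) /
TARGET-T6 §6 R3 — NOT carried by this file).

This file holds the CARRIERS only (definition lane; no display, no theorem): the printed objects of
Gan–Ichino 2014 §§3–5 (Invent. Math. 195 (2014) 509–672, journal layer
paper:doi-10-1007-s00222-013-0460-5, online-first pagination: layer page `p00NN` = online-first
p. NN = print page NN + 508 if the offset holds — unverified, t6-lit C14; pages below are
online-first) and of Mínguez 2008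
(Ann. Sci. ENS 41 (2008) 717–741, layer paper:doi-10-24033-asens-2080), rendered in the
vocabulary of seat p3's ACCEPTED Tier-5 files: a dual pair is a pair of abstract groups `G(W)`,
`H(V)`, its Weil representation `ω_{V,W,χ,ψ}` is a ℂ-linear `Representation` of the product (the
splitting `ι_{V,W,χ,ψ}`, the pair of characters `χ = (χ_V, χ_W)` and `ψ` enter only through this
DATUM — the print's construction of `ω` from `(V, W, χ, ψ)` is not carried), and the theta lift
of `π` is read off `Hom_{G(W)}(ω, π)` exactly as GI §5.1 defines it («the maximal π-isotypic
quotient of ω_{V,W,χ,ψ} is of the form π ⊠ Θ_{V,W,χ,ψ}(π)», online-first p. 19 ll. 24–27: that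
quotient is
non-zero iff a non-zero `G(W)`-map `ω → π` exists). Smoothness is seat p8's
`LevelPositivity.IsSmooth` (open stabilisers), irreducibility Mathlib's
`Representation.IsIrreducible`. Non-vacuity witnesses: `T6N42Toy.lean`.

README §8(d): uses an L-value-free non-vanishing device: NO (TIER5 §N4.2, a pre-02:16Z line of
record, continued).
-/

namespace Summit.Ventures.HodgeRepro2.T6.N42Defs

open Summit.Ventures.HodgeRepro2

/-- A reductive dual pair `(G(W), H(V))` with its Weil representation and one representation `π`
of `G(W)`, as Gan–Ichino 2014 §3.1 / §4.1 / §5.1 set it up over a non-archimedean local field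
(online-first p. 15 ll. 18–61: «Let `V` and `W` be vector spaces over `E` equipped with
non-degenerate
sesquilinear forms … Let `G(W)` and `H(V)` denote the isometry groups of `W` and `V`
respectively»; p. 17 ll. 14–20: «ω_{V,W,χ,ψ} := ω_ψ ∘ ι_{V,W,χ,ψ} of `G(W) × H(V)`»). The groups
are abstract topological groups, the Weil representation is a ℂ-linear representation of the
product — all DATA; nothing is constructed. -/
structure DualPairDatum where
  /-- `G(W)`, the isometry group of the (skew-hermitian) space `W`, with its topology (the
  `p`-adic one in print), for smoothness of `π`. -/
  G : Type
  [instGroupG : Group G]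
  [instTopG : TopologicalSpace G]
  /-- `H(V)`, the isometry group of the (hermitian) space `V`. -/
  H : Type
  [instGroupH : Group H]
  /-- The space of the Weil representation `ω_{V,W,χ,ψ}`. -/
  Ω : Type
  [instAddΩ : AddCommGroup Ω]
  [instModΩ : Module ℂ Ω]
  /-- The Weil representation `ω_{V,W,χ,ψ}` of `G(W) × H(V)` (GI online-first p. 17 l. 18). -/
  ω : Representation ℂ (G × H) Ω
  /-- The space of `π`. -/
  Vπ : Type
  [instAddVπ : AddCommGroup Vπ]
  [instModVπ : Module ℂ Vπ]
  /-- `π`, a representation of `G(W)` (GI online-first p. 19 l. 24: «an irreducible smooth (genuine)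
  representation π of G(W)» — irreducibility and smoothness are the hypotheses
  `DualPairDatum.Irreducible` / `DualPairDatum.Smooth` below, not fields). -/
  π : Representation ℂ G Vπ

namespace DualPairDatum

variable (S : DualPairDatum)

/-- The group structure of `G(W)`. -/
instance instGroupG' : Group S.G := S.instGroupG

/-- The topology of `G(W)`. -/
instance instTopG' : TopologicalSpace S.G := S.instTopG

/-- The group structure of `H(V)`. -/
instance instGroupH' : Group S.H := S.instGroupH

/-- The additive group of the Weil representation's space. -/
instance instAddΩ' : AddCommGroup S.Ω := S.instAddΩ

/-- The `ℂ`-module structure of the Weil representation's space. -/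
instance instModΩ' : Module ℂ S.Ω := S.instModΩ

/-- The additive group of the space of `π`. -/
instance instAddVπ' : AddCommGroup S.Vπ := S.instAddVπ

/-- The `ℂ`-module structure of the space of `π`. -/
instance instModVπ' : Module ℂ S.Vπ := S.instModVπ

/-- The Weil representation restricted to `G(W) × {1}`: the `G(W)`-module structure of `ω`. -/
def ωG : Representation ℂ S.G S.Ω :=
  S.ω.comp (MonoidHom.inl S.G S.H)

/-- `ωG` acts as `ω (g, 1)`. -/
theorem ωG_apply (g : S.G) : S.ωG g = S.ω (g, 1) := rfl

/-- «Θ_{V,W,χ,ψ}(π) ≠ 0», read off GI §5.1 (online-first p. 19 ll. 24–27): the maximal `π`-isotypic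
quotient
of `ω_{V,W,χ,ψ}` is `π ⊠ Θ_{V,W,χ,ψ}(π)`, and it is non-zero exactly when a non-zero
`G(W)`-equivariant linear map `ω → π` exists. -/
def ThetaNonzero : Prop :=
  ∃ f : S.Ω →ₗ[ℂ] S.Vπ, f ≠ 0 ∧ S.ωG.IsIntertwiningMap S.π f

/-- `π` is smooth: every stabiliser is open (seat p8's `LevelPositivity.IsSmooth`, Getz–Hahn
Def. 5.3 shape). -/
def Smooth : Prop :=
  LevelPositivity.IsSmooth S.π

/-- `π` is irreducible (Mathlib's `Representation.IsIrreducible`: non-zero with no proper non-zero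
subrepresentation). -/
def Irreducible : Prop :=
  S.π.IsIrreducible

end DualPairDatum

/-- Gan–Ichino 2014 §5.4 (online-first p. 22 ll. 4–12): «Let `V₀` be an anisotropic space over `E`,
and for
`r ≥ 0`, let `V_r = V₀ ⊕ H^r` with associated isometry groups `H(V_r)`, where `H` is the hyperbolic
plane. The collection `{V_r | r ≥ 0}` is called a Witt tower of spaces. … One can then consider a
tower of the theta correspondence associated to the tower of reductive dual pairs
`(G(W), H(V_r))`. For an irreducible smooth representation `π` of `G(W)`, we thus have the
representation `Θ_{V_r,W,χ,ψ}(π)` of `H(V_r)`.» The tower as data: one group `G(W)` with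
`n = dim W`, the groups `H(V_r)`, the Weil representations `ω_{V_r,W,χ,ψ}` and one `π`. -/
structure TowerDatum where
  /-- `G(W)`. -/
  G : Type
  [instGroupG : Group G]
  [instTopG : TopologicalSpace G]
  /-- `n = dim W` (GI online-first p. 15 l. 8), the bound of (5.1). -/
  n : ℕ
  /-- `H(V_r)`, the isometry group of the `r`-th member `V_r = V₀ ⊕ H^r` of the Witt tower. -/
  H : ℕ → Type
  [instGroupH : ∀ r, Group (H r)]
  /-- The space of `ω_{V_r,W,χ,ψ}`. -/
  Ω : ℕ → Type
  [instAddΩ : ∀ r, AddCommGroup (Ω r)]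
  [instModΩ : ∀ r, Module ℂ (Ω r)]
  /-- The Weil representation `ω_{V_r,W,χ,ψ}` of `G(W) × H(V_r)`. -/
  ω : ∀ r, Representation ℂ (G × H r) (Ω r)
  /-- The space of `π`. -/
  Vπ : Type
  [instAddVπ : AddCommGroup Vπ]
  [instModVπ : Module ℂ Vπ]
  /-- `π`, a representation of `G(W)`. -/
  π : Representation ℂ G Vπ

namespace TowerDatum

variable (T : TowerDatum)

/-- The group structure of `G(W)`. -/
instance instGroupG' : Group T.G := T.instGroupG

/-- The topology of `G(W)`. -/
instance instTopG' : TopologicalSpace T.G := T.instTopG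

/-- The group structure of `H(V_r)`. -/
instance instGroupH' (r : ℕ) : Group (T.H r) := T.instGroupH r

/-- The additive group of the space of `ω_{V_r,W,χ,ψ}`. -/
instance instAddΩ' (r : ℕ) : AddCommGroup (T.Ω r) := T.instAddΩ r

/-- The `ℂ`-module structure of the space of `ω_{V_r,W,χ,ψ}`. -/
instance instModΩ' (r : ℕ) : Module ℂ (T.Ω r) := T.instModΩ r

/-- The additive group of the space of `π`. -/
instance instAddVπ' : AddCommGroup T.Vπ := T.instAddVπ

/-- The `ℂ`-module structure of the space of `π`. -/
instance instModVπ' : Module ℂ T.Vπ := T.instModVπ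

/-- The `r`-th dual pair `(G(W), H(V_r))` of the tower, with `ω_{V_r,W,χ,ψ}` and `π`. -/
def pair (r : ℕ) : DualPairDatum where
  G := T.G
  H := T.H r
  Ω := T.Ω r
  ω := T.ω r
  Vπ := T.Vπ
  π := T.π

/-- «Θ_{V_r,W,χ,ψ}(π) ≠ 0» for the `r`-th member of the tower. -/
def Occurs (r : ℕ) : Prop :=
  (T.pair r).ThetaNonzero

/-- GI online-first p. 22 ll. 13–14: «The smallest non-negative integer `r₀` such that
`Θ_{V_{r₀},W,χ,ψ}(π) ≠ 0` is called the first occurrence index of `π` for the Witt tower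
`{V_r}`» — `r₀` occurs and no smaller index does. -/
def IsFirstOccurrenceIndex (r₀ : ℕ) : Prop :=
  T.Occurs r₀ ∧ ∀ r, r < r₀ → ¬ T.Occurs r

/-- `π` is smooth (as a representation of `G(W)`; the same for every member of the tower). -/
def Smooth : Prop :=
  LevelPositivity.IsSmooth T.π

/-- `π` is irreducible. -/
def Irreducible : Prop :=
  T.π.IsIrreducible

/-- The `r`-th pair's `π` is the tower's `π`. -/
theorem pair_π (r : ℕ) : (T.pair r).π = T.π := rfl

/-- `Occurs` unfolds to the `r`-th pair's `ThetaNonzero`. -/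
theorem occurs_iff (r : ℕ) : T.Occurs r ↔ (T.pair r).ThetaNonzero := Iff.rfl

end TowerDatum

/-- Mínguez 2008 p. 718 ll. 3–7 (layer p0003 ll. 30–34): «Soit `D` une algèbre à division de
centre `F` de dimension finie `d²` sur `F` et soient `n` et `m` des entiers strictement positifs.
… Le groupe `GL_n(D)` des matrices inversibles dans `M_n` sera noté `G_n`. Notons `ω_{n,m}` la
restriction de la représentation métaplectique à la paire duale `G_n × G_m`.» The type II datum:
the integers `n`, `m` and the dual pair `(G_n, G_m)` with `ω_{n,m}` and a representation `π` of
`G_n`, as a `DualPairDatum` (`G := G_n`, `H := G_m`, `ω := ω_{n,m}`). -/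
structure TypeIIDatum where
  /-- `n` (the size of `G_n = GL_n(D)`). -/
  n : ℕ
  /-- `m` (the size of `G_m = GL_m(D)`). -/
  m : ℕ
  /-- The dual pair `(G_n, G_m)` with `ω_{n,m}` and `π`. -/
  pair : DualPairDatum

namespace TypeIIDatum

variable (S : TypeIIDatum)

/-- «Hom_{G_n}(ω_{n,m}, π) ≠ 0». -/
def HomNonzero : Prop :=
  S.pair.ThetaNonzero

/-- `π` is smooth. -/
def Smooth : Prop :=
  S.pair.Smooth

/-- `π` is irreducible. -/
def Irreducible : Prop :=
  S.pair.Irreducible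

end TypeIIDatum

end Summit.Ventures.HodgeRepro2.T6.N42Defs
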